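import Summits.ABC.ABC.Theses.IneffectiveSubspace

/-!
# `UniformSadicTowerFour` (stmt-ABC-14937), line `flat-steep-split` (lead c5): the ONE-LOG AXIS
# U₁ = UPD(1,1) on the cell `ord_p(r) ≤ 2` (`p ∣ r² − 1`) is an elementary theorem, uniformly in
# both primes (lifting the exponent)

The one-logarithm axis **U₁ = UPD(1,1)** of the one-prime / two-base bound UPD(1,2) (sibling file
`…OneLogAxis.lean`: `oneBase_of_levelOneRung_two`, `oneBase_of_uniformSadicTowerFour`, …) asks,
for every `ε > 0`, for a constant `C` with

  `p^t ≤ C · (pr)^(1+ε) · (r^Z)^ε`  whenever `p ≠ r` are primes, `p^t ∣ r^Z − 1` and `r^Z ≥ 2`,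

and is OPEN uniformly in `(p, r)`.  This file shows that its cell **`ord_p(r) ≤ 2`**, i.e.
`p ∣ r² − 1` — which contains EVERY instance with `p = 2` or `p = 3` — is an unconditional,
elementary theorem, uniformly in both primes and all exponents:

* `oneBase_of_dvd_sq_sub_one` — U₁ on the cell `p ∣ r² − 1`, with `C = 4 / (ε log 2)`;
* `oneBase_modulus_two`, `oneBase_modulus_three` — the instances `p = 2` (every odd prime `r`
  has `2 ∣ r² − 1`) and `p = 3` (every prime `r ≠ 3` has `3 ∣ r² − 1`).

So the open content of U₁ is the cell `ord_p(r) ≥ 3` (the cyclotomic values `Φ_d(r)`, `d ≥ 3`, cf.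
`…OnePrimeCyclotomicSquare.lean`), which for each FIXED `p` is Ridout's theorem (sibling file
`…OneLogRidout.lean`).

**Proof.** The key integer bound is `p^t ≤ 4 r Z` whenever `p^t ∣ r^Z − 1`, `Z ≥ 1`, on the cell.
Since `r^Z − 1 ∣ (r^Z)² − 1 = (r²)^Z − 1`, `t ≤ v_p((r²)^Z − 1)`.  For ODD `p` the
lifting-the-exponent lemma (`padicValNat.pow_sub_pow`, base `r²`, `p ∣ r² − 1`, `p ∤ r²`) gives
`v_p((r²)^Z − 1) = v_p(r² − 1) + v_p(Z)`, and `p^{v_p(r² − 1)}` divides `(r + 1)(r − 1)` while being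
coprime to one of the two factors (an odd prime does not divide both `r − 1` and `r + 1 = (r − 1) + 2`),
so `p^{v_p(r² − 1)} ≤ r + 1` and `p^t ≤ (r + 1) · Z`.  For `p = 2` (`r` odd) the `2`-adic LTE
(`padicValNat.pow_two_sub_one`, exponent `2Z`) gives
`v₂(r^{2Z} − 1) = v₂(r + 1) + v₂(r − 1) + v₂(Z)`, and `r − 1`, `r + 1` are not both divisible by
`4`, so `2^{v₂(r+1)} · 2^{v₂(r−1)} ≤ 2 (r + 1)` and `2^t ≤ 2 (r + 1) Z`.  Finally
`(r^Z)^ε = exp(ε Z log r) ≥ 1 + ε Z log r ≥ ε Z log 2` gives `Z ≤ (r^Z)^ε / (ε log 2)`, and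
`r ≤ pr ≤ (pr)^(1+ε)`, whence `p^t ≤ 4 r Z ≤ (4 / (ε log 2)) · (pr)^(1+ε) · (r^Z)^ε`.

Sources: the lifting-the-exponent lemma [folklore] (Mathlib `Mathlib/NumberTheory/Multiplicity.lean`:
`padicValNat.pow_sub_pow`, `padicValNat.pow_two_sub_one`) and real-analysis bookkeeping
(`Real.add_one_le_exp`, `Real.rpow_def_of_pos`, `Real.rpow_le_rpow_of_exponent_le`); Mathlib only
(`pow_padicValNat_dvd`, `padicValNat_dvd_iff_le`, `padicValNat.mul`, `Nat.sub_dvd_pow_sub_pow`,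
`Nat.pow_two_sub_pow_two`, `Nat.Coprime.dvd_of_dvd_mul_left/right`).  No new definitions, no
hypotheses.  Deliberately NOT here: U₁ off the cell (OPEN), its fixed-modulus version via Ridout and
the other stubs of the line (other files).
-/

noncomputable section

-- `Summit.<Summit>.<Problem>` is the mandated summit-side namespace (CONVENTIONS §2); for the
-- single-conjunct summit `ABC` the two coincide, so the duplicate `ABC.ABC` is deliberate.
set_option linter.dupNamespace false

namespace Summit.ABC.ABC.Theorems.UniformSadicTowerFour.BoundedOmega

/-! ## The integer heart: `p^t ∣ r^Z − 1 ⟹ p^t ≤ 4 r Z` on the cell `p ∣ r² − 1` -/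

/-- **Odd `p` on the cell.** For primes `p ≠ r` with `p` odd and `p ∣ r² − 1`, and `Z ≠ 0`:
`p^t ∣ r^Z − 1 ⟹ p^t ≤ (r + 1) · Z`.  Indeed `p^t ∣ r^Z − 1 ∣ (r^Z)² − 1 = (r²)^Z − 1`, so
`t ≤ v_p((r²)^Z − 1) = v_p(r² − 1) + v_p(Z)` (lifting the exponent, base `r²`: `p ∣ r² − 1`,
`p ∤ r²`), `p^{v_p(Z)} ≤ Z`, and `p^{v_p(r² − 1)} ∣ (r + 1)(r − 1)` is coprime to one of the two
factors (an odd prime cannot divide both `r − 1` and `r + 1 = (r − 1) + 2`), hence divides the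
other and is `≤ r + 1`. [folklore] -/
private theorem osPow_le_of_odd {p r Z t : ℕ} (hp : p.Prime) (hr : r.Prime) (hpr : p ≠ r)
    (hodd : Odd p) (hcell : p ∣ r ^ 2 - 1) (hZ : Z ≠ 0) (ht : p ^ t ∣ r ^ Z - 1) :
    p ^ t ≤ (r + 1) * Z := by
  haveI := Fact.mk hp
  have hr2 : 2 ≤ r := hr.two_le
  have hx : 1 < r ^ 2 := by nlinarith
  -- `p ∤ r²` (else `p ∣ r`, `p = r`)
  have hndvd : ¬p ∣ r ^ 2 := fun h =>
    hpr ((Nat.prime_dvd_prime_iff_eq hp hr).1 (hp.dvd_of_dvd_pow h))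
  -- LTE: `v_p((r²)^Z − 1) = v_p(r² − 1) + v_p(Z)`
  have hlte : padicValNat p ((r ^ 2) ^ Z - 1) = padicValNat p (r ^ 2 - 1) + padicValNat p Z := by
    have h := padicValNat.pow_sub_pow hodd hx hcell hndvd hZ
    rwa [one_pow] at h
  -- `p^t ∣ r^Z − 1 ∣ (r^Z)² − 1 = (r²)^Z − 1 ≠ 0`
  have hsq : (r ^ 2) ^ Z - 1 = (r ^ Z) ^ 2 - 1 ^ 2 := by
    rw [← pow_mul, ← pow_mul, mul_comm, one_pow]
  have ht2 : p ^ t ∣ (r ^ 2) ^ Z - 1 := by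
    rw [hsq]
    exact ht.trans (Nat.sub_dvd_pow_sub_pow (r ^ Z) 1 2)
  have hne : (r ^ 2) ^ Z - 1 ≠ 0 := Nat.sub_ne_zero_of_lt (Nat.one_lt_pow hZ hx)
  have htle : t ≤ padicValNat p (r ^ 2 - 1) + padicValNat p Z :=
    hlte ▸ (padicValNat_dvd_iff_le hne).1 ht2
  -- `p^{v_p(r² − 1)} ≤ r + 1`
  have hv1 : p ^ padicValNat p (r ^ 2 - 1) ≤ r + 1 := by
    have hfac : r ^ 2 - 1 = (r + 1) * (r - 1) := by
      have h := Nat.pow_two_sub_pow_two r 1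
      rwa [one_pow] at h
    have hd : p ^ padicValNat p (r ^ 2 - 1) ∣ (r + 1) * (r - 1) := by
      rw [← hfac]
      exact pow_padicValNat_dvd
    -- `p ∤ 2` (an odd prime)
    have hp2 : ¬p ∣ 2 := fun h => by
      have h2 := (Nat.prime_dvd_prime_iff_eq hp Nat.prime_two).1 h
      obtain ⟨k, hk⟩ := hodd
      omega
    by_cases h1 : p ∣ r - 1
    · -- then `p ∤ r + 1 = (r − 1) + 2`, so `p^v ∣ r − 1 ≤ r + 1`
      have h3 : ¬p ∣ r + 1 := fun h' => hp2 (by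
        have h4 : r + 1 = (r - 1) + 2 := by omega
        rw [h4] at h'
        exact (Nat.dvd_add_right h1).1 h')
      have hco : Nat.Coprime (p ^ padicValNat p (r ^ 2 - 1)) (r + 1) :=
        Nat.Coprime.pow_left _ (hp.coprime_iff_not_dvd.2 h3)
      exact (Nat.le_of_dvd (by omega) (hco.dvd_of_dvd_mul_left hd)).trans (by omega)
    · -- `p ∤ r − 1`, so `p^v ∣ r + 1`
      have hco : Nat.Coprime (p ^ padicValNat p (r ^ 2 - 1)) (r - 1) :=
        Nat.Coprime.pow_left _ (hp.coprime_iff_not_dvd.2 h1)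
      exact Nat.le_of_dvd (Nat.succ_pos r) (hco.dvd_of_dvd_mul_right hd)
  have hv2 : p ^ padicValNat p Z ≤ Z := Nat.le_of_dvd (Nat.pos_of_ne_zero hZ) pow_padicValNat_dvd
  calc p ^ t ≤ p ^ (padicValNat p (r ^ 2 - 1) + padicValNat p Z) := Nat.pow_le_pow_right hp.pos htle
    _ = p ^ padicValNat p (r ^ 2 - 1) * p ^ padicValNat p Z := pow_add _ _ _
    _ ≤ (r + 1) * Z := Nat.mul_le_mul hv1 hv2

/-- **`p = 2` (the cell contains it: `r` is odd).** For a prime `r ≠ 2` and `Z ≠ 0`: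
`2^t ∣ r^Z − 1 ⟹ 2^t ≤ 2 (r + 1) · Z`.  Indeed `2^t ∣ r^Z − 1 ∣ r^{2Z} − 1`, and the `2`-adic
lifting-the-exponent lemma at the even exponent `2Z` reads
`v₂(r^{2Z} − 1) + 1 = v₂(r + 1) + v₂(r − 1) + v₂(2Z)`, i.e.
`v₂(r^{2Z} − 1) = v₂(r + 1) + v₂(r − 1) + v₂(Z)`; the consecutive even numbers `r − 1`, `r + 1`
are not both divisible by `4`, so `2^{v₂(r+1)} · 2^{v₂(r−1)} ≤ 2 (r + 1)`, and `2^{v₂(Z)} ≤ Z`.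
[folklore] -/
private theorem osPow_le_two {r Z t : ℕ} (hr : r.Prime) (h2r : 2 ≠ r) (hZ : Z ≠ 0)
    (ht : 2 ^ t ∣ r ^ Z - 1) : 2 ^ t ≤ 2 * (r + 1) * Z := by
  have hodd : ¬2 ∣ r := fun h => h2r ((Nat.prime_dvd_prime_iff_eq Nat.prime_two hr).1 h)
  have hr3 : 3 ≤ r := by have := hr.two_le; omega
  -- LTE at `p = 2` with the even exponent `2Z`, and `v₂(2Z) = 1 + v₂(Z)`
  have hlte : padicValNat 2 (r ^ (2 * Z) - 1) + 1 =
      padicValNat 2 (r + 1) + padicValNat 2 (r - 1) + padicValNat 2 (2 * Z) :=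
    padicValNat.pow_two_sub_one (by omega) hodd (by omega) (even_two_mul Z)
  have hmul : padicValNat 2 (2 * Z) = 1 + padicValNat 2 Z := by
    rw [padicValNat.mul (by norm_num) hZ, padicValNat_self]
  -- `2^t ∣ r^Z − 1 ∣ (r^Z)² − 1 = r^{2Z} − 1 ≠ 0`
  have hsq : r ^ (2 * Z) - 1 = (r ^ Z) ^ 2 - 1 ^ 2 := by
    rw [← pow_mul, mul_comm, one_pow]
  have ht2 : 2 ^ t ∣ r ^ (2 * Z) - 1 := by
    rw [hsq]
    exact ht.trans (Nat.sub_dvd_pow_sub_pow (r ^ Z) 1 2)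
  have hne : r ^ (2 * Z) - 1 ≠ 0 := Nat.sub_ne_zero_of_lt (Nat.one_lt_pow (by omega) (by omega))
  have htle : t ≤ padicValNat 2 (r + 1) + padicValNat 2 (r - 1) + padicValNat 2 Z := by
    have := (padicValNat_dvd_iff_le hne).1 ht2
    omega
  -- `2^{v₂(r+1)} · 2^{v₂(r−1)} ≤ 2 (r + 1)`
  have hA : 2 ^ padicValNat 2 (r + 1) ∣ r + 1 := pow_padicValNat_dvd
  have hB : 2 ^ padicValNat 2 (r - 1) ∣ r - 1 := pow_padicValNat_dvd
  have hAB : 2 ^ padicValNat 2 (r + 1) * 2 ^ padicValNat 2 (r - 1) ≤ 2 * (r + 1) := by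
    by_cases h4 : 4 ∣ r + 1
    · -- `4 ∤ r − 1`, so `v₂(r − 1) ≤ 1`
      have h4' : ¬2 ^ 2 ∣ r - 1 := by
        rw [show (2 : ℕ) ^ 2 = 4 by norm_num]
        omega
      have hv : padicValNat 2 (r - 1) ≤ 1 := by
        have := mt (padicValNat_dvd_iff_le (p := 2) (n := 2) (by omega : r - 1 ≠ 0)).2 h4'
        omega
      have hB' : 2 ^ padicValNat 2 (r - 1) ≤ 2 :=
        (Nat.pow_le_pow_right two_pos hv).trans (pow_one 2).le
      have hA' : 2 ^ padicValNat 2 (r + 1) ≤ r + 1 := Nat.le_of_dvd (Nat.succ_pos r) hA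
      calc 2 ^ padicValNat 2 (r + 1) * 2 ^ padicValNat 2 (r - 1) ≤ (r + 1) * 2 :=
            Nat.mul_le_mul hA' hB'
        _ = 2 * (r + 1) := mul_comm _ _
    · -- `4 ∤ r + 1`, so `v₂(r + 1) ≤ 1`
      have h4' : ¬2 ^ 2 ∣ r + 1 := by
        rwa [show (2 : ℕ) ^ 2 = 4 by norm_num]
      have hv : padicValNat 2 (r + 1) ≤ 1 := by
        have := mt (padicValNat_dvd_iff_le (p := 2) (n := 2) (by omega : r + 1 ≠ 0)).2 h4'
        omega
      have hA' : 2 ^ padicValNat 2 (r + 1) ≤ 2 :=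
        (Nat.pow_le_pow_right two_pos hv).trans (pow_one 2).le
      have hB' : 2 ^ padicValNat 2 (r - 1) ≤ r + 1 :=
        (Nat.le_of_dvd (by omega) hB).trans (by omega)
      exact Nat.mul_le_mul hA' hB'
  have hv2 : 2 ^ padicValNat 2 Z ≤ Z := Nat.le_of_dvd (Nat.pos_of_ne_zero hZ) pow_padicValNat_dvd
  calc 2 ^ t ≤ 2 ^ (padicValNat 2 (r + 1) + padicValNat 2 (r - 1) + padicValNat 2 Z) :=
        Nat.pow_le_pow_right two_pos htle
    _ = 2 ^ padicValNat 2 (r + 1) * 2 ^ padicValNat 2 (r - 1) * 2 ^ padicValNat 2 Z := by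
        rw [pow_add, pow_add]
    _ ≤ 2 * (r + 1) * Z := Nat.mul_le_mul hAB hv2

/-- **The integer bound on the cell.** For primes `p ≠ r` with `p ∣ r² − 1` and `Z ≠ 0`:
`p^t ∣ r^Z − 1 ⟹ p^t ≤ 4 r Z` — from `osPow_le_two` (`p = 2`: `2 (r + 1) Z ≤ 4 r Z`) and
`osPow_le_of_odd` (odd `p`: `(r + 1) Z ≤ 4 r Z`). [folklore] -/
private theorem osPow_le {p r Z t : ℕ} (hp : p.Prime) (hr : r.Prime) (hpr : p ≠ r)
    (hcell : p ∣ r ^ 2 - 1) (hZ : Z ≠ 0) (ht : p ^ t ∣ r ^ Z - 1) : p ^ t ≤ 4 * r * Z := by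
  have hr2 : 2 ≤ r := hr.two_le
  rcases hp.eq_two_or_odd' with rfl | hodd
  · calc 2 ^ t ≤ 2 * (r + 1) * Z := osPow_le_two hr hpr hZ ht
      _ ≤ 4 * r * Z := Nat.mul_le_mul_right Z (by omega)
  · calc p ^ t ≤ (r + 1) * Z := osPow_le_of_odd hp hr hpr hodd hcell hZ ht
      _ ≤ 4 * r * Z := Nat.mul_le_mul_right Z (by omega)

/-! ## Real bookkeeping: `Z · (ε log 2) ≤ (r^Z)^ε` -/

/-- For `r ≥ 2`, `ε > 0` and every `Z ∈ ℕ`: `Z · (ε · log 2) ≤ (r^Z)^ε` — since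
`(r^Z)^ε = exp(Z · log r · ε) ≥ Z · log r · ε + 1` (`Real.add_one_le_exp`) and `log 2 ≤ log r`.
[folklore] -/
private theorem osZ_mul_le {r : ℕ} (Z : ℕ) (hr : 2 ≤ r) {ε : ℝ} (hε : 0 < ε) :
    (Z : ℝ) * (ε * Real.log 2) ≤ ((r ^ Z : ℕ) : ℝ) ^ ε := by
  have hr0 : (0 : ℝ) < r := by exact_mod_cast (by omega : 0 < r)
  have hlog : Real.log 2 ≤ Real.log r := Real.log_le_log two_pos (by exact_mod_cast hr)
  rw [Nat.cast_pow, Real.rpow_def_of_pos (pow_pos hr0 Z), Real.log_pow]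
  calc (Z : ℝ) * (ε * Real.log 2) ≤ Z * (ε * Real.log r) := by gcongr
    _ = Z * Real.log r * ε := by ring
    _ ≤ Z * Real.log r * ε + 1 := by linarith
    _ ≤ Real.exp (Z * Real.log r * ε) := Real.add_one_le_exp _

/-! ## U₁ on the cell `p ∣ r² − 1`, uniformly in both primes -/

/-- **U₁ = UPD(1,1) on the cell `ord_p(r) ≤ 2` is a theorem, uniformly in both primes.**  For every
`ε > 0` there is `C > 0` (namely `C = 4 / (ε log 2)`) such that for all primes `p ≠ r` with
`p ∣ r² − 1` and all `Z, t ∈ ℕ` with `p^t ∣ r^Z − 1` and `r^Z ≥ 2`: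
`p^t ≤ C · (pr)^(1+ε) · (r^Z)^ε`.  Proof: the integer bound `p^t ≤ 4 r Z` (`osPow_le`, lifting the
exponent), `r ≤ pr ≤ (pr)^(1+ε)` and `Z ≤ (r^Z)^ε / (ε log 2)` (`osZ_mul_le`). [folklore] -/
theorem oneBase_of_dvd_sq_sub_one :
    ∀ ε : ℝ, 0 < ε → ∃ C : ℝ, 0 < C ∧ ∀ p r : ℕ, p.Prime → r.Prime → p ≠ r → p ∣ r ^ 2 - 1 →
      ∀ Z t : ℕ, p ^ t ∣ r ^ Z - 1 → 2 ≤ r ^ Z →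
      ((p ^ t : ℕ) : ℝ) ≤ C * ((p * r : ℕ) : ℝ) ^ (1 + ε) * ((r ^ Z : ℕ) : ℝ) ^ ε := by
  intro ε hε
  have hL : 0 < ε * Real.log 2 := mul_pos hε (Real.log_pos one_lt_two)
  refine ⟨4 / (ε * Real.log 2), div_pos four_pos hL, ?_⟩
  intro p r hp hr hpr hcell Z t ht h2
  have hZ : Z ≠ 0 := by
    rintro rfl
    rw [pow_zero] at h2
    omega
  -- the integer bound and the two real estimates
  have hnat : p ^ t ≤ 4 * r * Z := osPow_le hp hr hpr hcell hZ ht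
  have hPR1 : (1 : ℝ) ≤ ((p * r : ℕ) : ℝ) := by
    exact_mod_cast Nat.one_le_iff_ne_zero.2 (Nat.mul_ne_zero hp.ne_zero hr.ne_zero)
  have hR : (r : ℝ) ≤ ((p * r : ℕ) : ℝ) ^ (1 + ε) :=
    calc (r : ℝ) ≤ ((p * r : ℕ) : ℝ) := by exact_mod_cast Nat.le_mul_of_pos_left r hp.pos
      _ = ((p * r : ℕ) : ℝ) ^ (1 : ℝ) := (Real.rpow_one _).symm
      _ ≤ ((p * r : ℕ) : ℝ) ^ (1 + ε) := Real.rpow_le_rpow_of_exponent_le hPR1 (by linarith)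
  have hZ' : (Z : ℝ) ≤ ((r ^ Z : ℕ) : ℝ) ^ ε / (ε * Real.log 2) :=
    (le_div_iff₀ hL).2 (osZ_mul_le Z hr.two_le hε)
  calc ((p ^ t : ℕ) : ℝ) ≤ 4 * (r : ℝ) * (Z : ℝ) := by exact_mod_cast hnat
    _ ≤ 4 * ((p * r : ℕ) : ℝ) ^ (1 + ε) * (((r ^ Z : ℕ) : ℝ) ^ ε / (ε * Real.log 2)) := by
        gcongr
    _ = 4 / (ε * Real.log 2) * ((p * r : ℕ) : ℝ) ^ (1 + ε) * ((r ^ Z : ℕ) : ℝ) ^ ε := by ring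

/-! ## The instances `p = 2` and `p = 3` -/

/-- **U₁ at the prime `p = 2`, for every odd prime base.**  For every `ε > 0` there is `C > 0` with
`2^t ≤ C · (2r)^(1+ε) · (r^Z)^ε` whenever `r ≠ 2` is prime, `2^t ∣ r^Z − 1` and `r^Z ≥ 2`: the
case `p = 2` of `oneBase_of_dvd_sq_sub_one`, since `2 ∣ r² − 1` for odd `r`. [folklore] -/
theorem oneBase_modulus_two :
    ∀ ε : ℝ, 0 < ε → ∃ C : ℝ, 0 < C ∧ ∀ r : ℕ, r.Prime → 2 ≠ r → ∀ Z t : ℕ,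
      2 ^ t ∣ r ^ Z - 1 → 2 ≤ r ^ Z →
      ((2 ^ t : ℕ) : ℝ) ≤ C * ((2 * r : ℕ) : ℝ) ^ (1 + ε) * ((r ^ Z : ℕ) : ℝ) ^ ε := by
  intro ε hε
  obtain ⟨C, hC, H⟩ := oneBase_of_dvd_sq_sub_one ε hε
  refine ⟨C, hC, fun r hr h2r Z t ht h2 => H 2 r Nat.prime_two hr h2r ?_ Z t ht h2⟩
  -- `2 ∣ r² − 1` for the odd prime `r`
  have hodd : Odd r := hr.odd_of_ne_two fun h => h2r h.symm
  exact (Nat.Odd.sub_odd hodd.pow odd_one).two_dvd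

/-- **U₁ at the prime `p = 3`, for every prime base `r ≠ 3`.**  For every `ε > 0` there is `C > 0`
with `3^t ≤ C · (3r)^(1+ε) · (r^Z)^ε` whenever `r ≠ 3` is prime, `3^t ∣ r^Z − 1` and `r^Z ≥ 2`:
the case `p = 3` of `oneBase_of_dvd_sq_sub_one`, since `r ≡ ±1 (mod 3)` gives `3 ∣ r² − 1`.
[folklore] -/
theorem oneBase_modulus_three :
    ∀ ε : ℝ, 0 < ε → ∃ C : ℝ, 0 < C ∧ ∀ r : ℕ, r.Prime → 3 ≠ r → ∀ Z t : ℕ,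
      3 ^ t ∣ r ^ Z - 1 → 2 ≤ r ^ Z →
      ((3 ^ t : ℕ) : ℝ) ≤ C * ((3 * r : ℕ) : ℝ) ^ (1 + ε) * ((r ^ Z : ℕ) : ℝ) ^ ε := by
  intro ε hε
  obtain ⟨C, hC, H⟩ := oneBase_of_dvd_sq_sub_one ε hε
  refine ⟨C, hC, fun r hr h3r Z t ht h2 => H 3 r Nat.prime_three hr h3r ?_ Z t ht h2⟩
  -- `3 ∣ r² − 1` for a prime `r ≠ 3`: `r % 3 ∈ {1, 2}`, so `r² % 3 = 1`
  have h3 : ¬3 ∣ r := fun h => h3r ((Nat.prime_dvd_prime_iff_eq Nat.prime_three hr).1 h)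
  have hmod : r ^ 2 % 3 = 1 := by
    rw [Nat.pow_mod]
    have h12 : r % 3 = 1 ∨ r % 3 = 2 := by omega
    rcases h12 with h | h <;> rw [h]
  have hdvd := Nat.dvd_sub_mod (n := 3) (r ^ 2)
  rwa [hmod] at hdvd

end Summit.ABC.ABC.Theorems.UniformSadicTowerFour.BoundedOmega

end
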